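import Mathlib
import HarnessLib
import Summits.HubbardSuperconductivity.HubbardSuperconductivity.Theorems.KLProgrammeKLRegimeEngineTowerWtAssemblyKlEngClosedSharp4C2
import Summits.HubbardSuperconductivity.HubbardSuperconductivity.Theorems.KLProgrammeKLRegimeEngineTowerWtAssemblyKlEngFinal
import Summits.HubbardSuperconductivity.HubbardSuperconductivity.Theorems.KLProgrammeKLRegimeEngineScaleOneDatumWtKlEng
import Summits.HubbardSuperconductivity.HubbardSuperconductivity.Theorems.KLProgrammeKLRegimeEngineTowerWtNumericsPackageWN
import Summits.HubbardSuperconductivity.HubbardSuperconductivity.Theorems.KLProgrammeKLRegimeEngineTowerWtNumericsGroup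
import Summits.HubbardSuperconductivity.HubbardSuperconductivity.Theorems.KLProgrammeKLRegimeEngineTowerWtNumericsZGuard
import Summits.HubbardSuperconductivity.HubbardSuperconductivity.Theorems.KLProgrammeKLRegimeEngineTowerWtNumericsCouplings
import Summits.HubbardSuperconductivity.HubbardSuperconductivity.Theorems.KLProgrammeKLRegimeEngineTowerLevAssemblyKlEngNum
import Summits.HubbardSuperconductivity.HubbardSuperconductivity.Theorems.KLProgrammeKLRegimeEngineTowerWtNumericsSixDom
import Summits.HubbardSuperconductivity.HubbardSuperconductivity.Theorems.KLProgrammeKLRegimeEngineTowerWtAssemblyKlEngNum4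
import Summits.HubbardSuperconductivity.HubbardSuperconductivity.Theorems.KLProgrammeKLRegimeEngineTowerWtAssemblyKlEngClosedSharp4C2Cut

/-!
# Route `KLProgramme` — crux K3 ENGINE (stmt-HubbardSuperconductivity-20437 `KLRegimeEngineV17F2`), ROW (b) binder #5 (E1's (E4) conjunct), cure (α) of located #25
# «(b)-PLAIN-UV-TAIL», LINK 4d: ♯4 numW4 «THE WEIGHTED CLAUSE AT EVERY LEVEL MODULO E1's STRUCTURAL ROWS ONLY» WITH THE TWO WEIGHTED PLAIN FOUR-LEG LINES
# (import `s₄`, cell `t₄`) STATED FOR THE UV-CUT ELEMENTS (cell gate-hubbard-kl, seat hubbard-kl-k3c2-p2 g34; twin of ✓ `kernelNormsWt4_all_klEng_numW4` (p4 g23);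
# pen (R669)/(R673))

WHAT CHANGES vs `…Num4` (everything else token-identical — head `∃ d₀ ≥ 2, ∀ d ≥ d₀, ∃ CW₄ > 0, …`, E1's λ-class amplitudes `s₄ S₆ t₄`, the numerics' closed forms
`Bf uf CEf ug s₂m`, doors, regime, the input-family two- and six-leg cells, `CEf ≤ Qe.CE`, `IsRaiseOf`, conclusion): the two E1 four-leg hypotheses — the weighted PLAIN
four-leg import line of the block input `𝒱_{dk}[K_n]` (`≤ s₄·(Bf·ε_j)`) and the weighted PLAIN four-leg cell line of `𝒱_j[K_n]` (`≤ t₄·ε_j`) — are stated for the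
leg-rescaled elements `S_ĝ 𝒱 := ExteriorAlgebra.map (LinearMap.mulLeft ℂ ĝ) 𝒱`, `ĝ((k,σ),c) = gnScaleCutoff 4 klE0 1 |ω_k|` (one-sector UV cut `≡ 1` for `|ω| ≤ klE0`;
located #25 ✓ p765343; absorption ✓ p766263/p765436).  Proof = the original's on `kernelNormsWt4_all_klEng_closed_sharp4C2_cut` (LINK 4c), numerics packages unchanged.
* **`kernelNormsWt4_all_klEng_numW4_cut (R c″)`** ⊢ same head, `∀ j ≤ n, KernelNormsWt4 …`.  Composition of landed theorems; the E1 rows stay hypotheses; nothing asserts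
(b), WT4's E1 rows, any stub of 20437, K3 or superconductivity.  References: BGM 2006 §2.5 (2.48), §2.8 (2.76)–(2.84), §3 (3.2)–(3.8) [cite: BenfattoGiulianiMastropietro2006].
-/

noncomputable section

namespace Summit.HubbardSuperconductivity.HubbardSuperconductivity.Theorems.EngineV8

set_option linter.dupNamespace false -- summit = problem name (single-conjunct summit), D-0017

open Classical
open Real Finset Literature.MathematicalPhysics.QuantumLattice Literature.Probability.LatticeModels GrassmannAlgebra
open Literature.MathematicalPhysics.QuantumLattice.FermiRG Literature.MathematicalPhysics.QuantumLattice.FermiRG.BGM2006Routing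
open Summit.HubbardSuperconductivity.HubbardSuperconductivity.Theorems.KLProgrammeLegKernels
open Summit.HubbardSuperconductivity.HubbardSuperconductivity.Theorems.KLRegimeSplit
open Summit.HubbardSuperconductivity.HubbardSuperconductivity.Theorems.KLRegimeWick
open Summit.HubbardSuperconductivity.HubbardSuperconductivity.Theorems.TwoPointAssembly
open Summit.HubbardSuperconductivity.HubbardSuperconductivity.Theorems.DispersionFlow
open Summit.HubbardSuperconductivity.HubbardSuperconductivity.Theorems.TorusFourierL2

set_option maxHeartbeats 3000000 in -- one ~190-binder composition + four numerics packages' closed forms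
/-- **THE WEIGHTED CLAUSE AT EVERY LEVEL MODULO E1's STRUCTURAL ROWS ONLY (FOUR-LEG PLAIN LINES UV-CUT), ♯4** («D-ORDER» cured: `d ≥ d₀` chosen; two- and six-leg imports as input-family
sectorised cells with free amplitudes `S₂` (under `s₂m`) and `S₆`, the four-leg cell λ-class with `t₄`; both count thresholds absorbed into `CEf`; every numerics
binder of `kernelNormsWt4_all_klEng_closed_sharp4C2` discharged, the level-0 data supplied; see the module docstring).
[cite: BenfattoGiulianiMastropietro2006, §2.8 (2.76)-(2.84), (2.77), (2.93)-(2.98), Lemma 2.5, §3 (3.2)-(3.8)] -/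
theorem kernelNormsWt4_all_klEng_numW4_cut (R : RenConsts) (c'' : ℝ) (hc'' : 0 < c'') :
    ∃ d₀ : ℕ, 2 ≤ d₀ ∧ ∀ d : ℕ, d₀ ≤ d → ∃ CW₄ : ℝ, 0 < CW₄ ∧
      (R.WF2 → ∃ c₃' : ℝ, 0 < c₃' ∧ ∃ U₀' : ℝ, 0 < U₀' ∧
      ∀ P : SplitConsts, P.WF → ∃ c₀ : ℝ, 0 < c₀ ∧ ∃ U₁ : ℝ, 0 < U₁ ∧
      -- E1's λ-class amplitudes: four-leg import `s₄`, (C1′) six-leg cell `S₆`, four-leg cell `t₄`; then the numerics' OUTPUTS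
      ∀ (s₄ S₆ t₄ : ℝ), 0 ≤ s₄ → 0 ≤ S₆ → 0 ≤ t₄ →
      ∃ Bf uf CEf ug s₂m : ℝ, 1 ≤ Bf ∧ 0 < uf ∧ 0 ≤ CEf ∧ 0 < ug ∧ 0 < s₂m ∧
      (∀ (G : GeoConsts) (Q : EngConsts) (c : ℝ), 0 < c → c ≤ klEngC₃6 P R → c ≤ c₃' → c ≤ c₀ → c ≤ ug →
      ∀ μ ∈ klWindowC, ∀ U : ℝ, 0 < U → U ≤ klEngU₀9 P R c → U ≤ U₀' → U ≤ U₁ → c'' * U ≤ 1 →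
        U ≤ uf / (2 * Bf * P.Klam + 1) → U ≤ 1 / ((d : ℝ) + 1) → U ≤ ug →
      ∀ β : ℝ, klBetaMin ≤ β → β ≤ Real.exp (c / U ^ 2) →
      ∀ (L M : ℕ) [NeZero L] [NeZero M], klEngL₃ β U ≤ L → klEngM₃ β U L ≤ M →
      ∀ n : ℕ, 1 ≤ n → n ≤ nScales β + 1 → IsKLRegime U c (-(n : ℤ)) → HistP klPredsV17F2 L M G P Q R β U μ 0 n →
        (∀ m', 1 ≤ m' → m' < n → FlowPieceOscAt L M c'' β U μ m') →
      c ≤ uf * Real.log 4 / (2 * Bf * P.Klam + 1) →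
      -- E1: the INPUT-FAMILY sectorised two-leg cells (c-class, λ-free) under the threshold `S₂ ≤ s₂m`, the plain four-leg import at `Bf·ε_j`, the INPUT-FAMILY six-leg cells
      ∀ S₂ : ℝ, 0 ≤ S₂ → S₂ ≤ s₂m →
      (∀ j, d ≤ j → j ≤ n → ∀ k, 1 ≤ k → d * k ≤ j → ∀ (q : Fin 2) (w : SpaceTimeIdx L M × SectorLeg (sectorCount (d * k - 1))),
        klWtPinnedSumOf L M β μ (klFlowFrameU L M β U μ n) (d * k - 1) 2 (klEffectiveAction L M β U μ (klFlowFrameU L M β U μ n) klE0 (d * k)) q w ≤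
          S₂ * ((4 : ℝ) ^ (d * k - 1))⁻¹) →
      (∀ j, d ≤ j → j ≤ n → ∀ k, 1 ≤ k → d * k ≤ j → ∀ (q : Fin 4) (τ' : Fin 4 → SectorLeg 1) (y' : SpaceTimeIdx L M),
        imagTimeWeight β M ^ 3 * ∑ x' ∈ univ.filter (fun x' : Fin 4 → SpaceTimeIdx L M => x' q = y'),
          klScaleWt L M β j ((univ.image x').image (fun x : SpaceTimeIdx L M => (((((2 * (x.1 : ℕ) : ℕ)) : ZMod (2 * (2 * M)))), x.2))) *
            ‖sectorisedKernel L M β (trivialMultiplier L M)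
              (ExteriorAlgebra.map (LinearMap.mulLeft ℂ (fun K : HubbardFieldIdx L M => ((gnScaleCutoff 4 klE0 1 |matsubaraFreq β M K.1.1.1| : ℝ) : ℂ))) (klTowerInput L M β U μ (klFlowFrameU L M β U μ n) d k)) 4 τ' x'‖ ≤ s₄ * (Bf * epsCoupling P U j)) →
      (∀ j, d ≤ j → j ≤ n → ∀ (q : Fin 6) (w : SpaceTimeIdx L M × SectorLeg (sectorCount (j - 1))),
        klWtPinnedSumOf L M β μ (klFlowFrameU L M β U μ n) (j - 1) 6 (klEffectiveAction L M β U μ (klFlowFrameU L M β U μ n) klE0 j) q w ≤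
          S₆ * epsCoupling P U j ^ 2 * (2 : ℝ) ^ (4 * j)) →
      -- the budget package: its `CE` above the numerics' threshold (which absorbs the six-leg cell threshold), a raise of `klEngQ7 P R`
      ∀ Qe : EngConsts, CEf ≤ Qe.CE → (klEngQ7 P R).IsRaiseOf Qe →
      -- E1: the plain four-leg CELL line of `𝒱_j[K_n]` at `1 ≤ j ≤ n`, λ-class with the free amplitude `t₄` (its count threshold is absorbed into `CEf`)
      (∀ j, 1 ≤ j → j ≤ n → ∀ (q : Fin 4) (τ' : Fin 4 → SectorLeg 1) (y' : SpaceTimeIdx L M),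
        imagTimeWeight β M ^ 3 * ∑ x' ∈ univ.filter (fun x' : Fin 4 → SpaceTimeIdx L M => x' q = y'),
          klScaleWt L M β j ((univ.image x').image (fun x : SpaceTimeIdx L M => (((((2 * (x.1 : ℕ) : ℕ)) : ZMod (2 * (2 * M)))), x.2))) *
            ‖sectorisedKernel L M β (trivialMultiplier L M)
              (ExteriorAlgebra.map (LinearMap.mulLeft ℂ (fun K : HubbardFieldIdx L M => ((gnScaleCutoff 4 klE0 1 |matsubaraFreq β M K.1.1.1| : ℝ) : ℂ))) (klEffectiveAction L M β U μ (klFlowFrameU L M β U μ n) klE0 j)) 4 τ' x'‖ ≤ t₄ * epsCoupling P U j) →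
      ∀ j, j ≤ n → KernelNormsWt4 L M (klWtBudget P Qe U j) β U μ (klFlowFrameU L M β U μ n) j)) := by
  obtain ⟨C₁, C₂, Cκ, CJ, C₁r, C₂r, Cκr, CJr, C₁i, C₂i, hC₁, hC₂, hCκ, hCJ, hC₁r, hC₂r, hCκr, hCJr, hC₁i, hC₂i, C₆c, hC₆c, hallU⟩ :=
    kernelNormsWt4_all_klEng_closed_sharp4C2_cut R c'' hc''
  obtain ⟨d₀, hd₀2, hd₀⟩ := exists_blockLen_ge (max 1 ((81 * max CJ CJr) ^ 2 / 8) * C₂ ^ 2 * (8 * exp 4))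
  refine ⟨d₀, hd₀2, fun d hdd => ?_⟩
  have hd : 2 ≤ d := hd₀2.trans hdd
  have hblkW : max 1 ((81 * max CJ CJr) ^ 2 / 8) * C₂ ^ 2 * (8 * exp 4) ≤ (2 : ℝ) ^ (d - 1) := hd₀ d hdd
  obtain ⟨Cb, Cbr, hCb, hCbr, Cinc₁, Dinc₁, hCinc₁, hDinc₁, Cκ₀, CJ₀, Cα, hCκ₀, hCJ₀, hCα, Cκz, Cbz, CJz, hCκz, hCbz, hCJz, CWi, CW₄, hCWi, hCW₄,
    Cinc₂, Dinc₂, hCinc₂, hDinc₂, Cκ₁, CJ₁, Cα₁, hCκ₁, hCJ₁, hCα₁, hall⟩ := hallU d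
  -- the names are taken at the max-dominants
  set Cκm : ℝ := max Cκ Cκr with hCκm
  set Cbm : ℝ := max Cb Cbr with hCbm
  set CJm : ℝ := max CJ CJr with hCJm
  have hCκm0 : 0 < Cκm := lt_max_of_lt_left hCκ
  have hCbm0 : 0 < Cbm := lt_max_of_lt_left hCb
  have hCJm0 : 0 < CJm := lt_max_of_lt_left hCJ
  refine ⟨CW₄, hCW₄, fun hR2 => ?_⟩
  obtain ⟨c₃a, hc₃a, U₀a, hU₀a, hall'⟩ := hall hR2
  refine ⟨c₃a, hc₃a, U₀a, hU₀a, fun P hP => ?_⟩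
  obtain ⟨c₀, hc₀, U₁, hU₁, hall''⟩ := hall' P hP
  obtain ⟨A₁, P₁, T₁, hA₁, hP₁, hT₁, c₀w, hc₀w, U₀w, hU₀w, hdatW⟩ := exists_levelZeroDatumWt_klEng P R hP hR2
  obtain ⟨A₁', P₁', T₁', hA₁', hP₁', hT₁', c₀p, hc₀p, U₀p, hU₀p, hdatP⟩ := exists_levelZeroDatum_klEng P R hP hR2
  refine ⟨min c₀ (min c₀w c₀p), lt_min hc₀ (lt_min hc₀w hc₀p), min U₁ (min U₀w U₀p), lt_min hU₁ (lt_min hU₀w hU₀p), ?_⟩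
  intro s₄ S₆ t₄ hs₄ hS₆ ht₄
  have hK1 : 1 ≤ P.Klam := hP.1
  have hK0 : 0 < P.Klam := lt_of_lt_of_le one_pos hK1
  have he0 : (0 : ℝ) < klE0 := by norm_num [klE0]
  have hd1 : (1 : ℝ) ≤ (d : ℝ) + 1 := by have : (0 : ℝ) ≤ d := Nat.cast_nonneg d; linarith
  -- §A the r-free closed forms: block 0's base group (index ₀, constants `Cinc₁ Dinc₁ Cκ₀ CJ₀ Cα`, κ = 1), its levels group (index ₁, `Cinc₂ Dinc₂ Cκ₁ CJ₁ Cα₁`,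
  -- κ = d + 1), the Z-thread (index z), then the main tower (amplitudes `ab := aT₁⁰`, `qb := qT₁⁰`)
  obtain ⟨ab₀, hab₀⟩ : ∃ x : ℝ, x = A₁ / (2 * P.Klam ^ 2) := ⟨_, rfl⟩; obtain ⟨qb₀, hqb₀⟩ : ∃ x : ℝ, x = 4 * P₁ := ⟨_, rfl⟩
  obtain ⟨Z₀₀, hZ₀₀⟩ : ∃ x : ℝ, x = (81 * CJ₀) ^ 2 / 8 := ⟨_, rfl⟩; obtain ⟨i₂₀, hi₂₀⟩ : ∃ x : ℝ, x = 8 * 16 * Z₀₀ ^ 2 * A₁ * P₁ ^ 2 / P.Klam := ⟨_, rfl⟩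
  obtain ⟨t₀₀, ht₀₀⟩ : ∃ x : ℝ, x = 4 * exp 4 * (2 * Cκ₀ * klE0) / (162 ^ 2 * CJ₀ ^ 2) := ⟨_, rfl⟩; obtain ⟨p₀₀, hp₀₀⟩ : ∃ x : ℝ, x = 162 ^ 2 * CJ₀ ^ 2 / (2 * Cκ₀ * klE0) := ⟨_, rfl⟩
  obtain ⟨φ₀₀, hφ₀₀⟩ : ∃ x : ℝ, x = exp 1 * Cα / (Cκ₀ * klE0) := ⟨_, rfl⟩; obtain ⟨QH₀, hQH₀⟩ : ∃ x : ℝ, x = Z₀₀ * qb₀ + 1 := ⟨_, rfl⟩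
  obtain ⟨sC₀, hsC₀⟩ : ∃ x : ℝ, x = i₂₀ / (2 * (Z₀₀ * qb₀)) + 16 * ab₀ * QH₀ ^ 3 / (4 * (Z₀₀ * qb₀) ^ 2) + 16 * ab₀ * QH₀ / 4 := ⟨_, rfl⟩
  obtain ⟨Θ₀, hΘ₀⟩ : ∃ x : ℝ, x = exp 1 ^ 2 * φ₀₀ * t₀₀ ^ 2 * i₂₀ + exp 1 ^ 3 * φ₀₀ * t₀₀ ^ 3 * (16 * ab₀ * QH₀ ^ 3) +
    exp 1 ^ 3 * φ₀₀ * t₀₀ ^ 3 * (16 * ab₀) * QH₀ ^ 3 := ⟨_, rfl⟩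
  obtain ⟨uf₀, huf₀⟩ : ∃ x : ℝ, x = min 1 (min (1 / (8 * (2 * Cκ₀ * klE0 / (162 ^ 2 * CJ₀ ^ 2)) * QH₀ + 1))
    (min (1 / (2 * exp 1 * t₀₀ * QH₀ + 1)) (1 / (4 * Θ₀ + 1)))) := ⟨_, rfl⟩
  obtain ⟨aT₁g, haT₁g⟩ : ∃ x : ℝ, x = Cinc₁ * (ab₀ + 16 * ab₀ + exp 1 * φ₀₀ * t₀₀ * (1 + sC₀) ^ 2 / (Z₀₀ * qb₀)) := ⟨_, rfl⟩
  obtain ⟨qT₁g, hqT₁g⟩ : ∃ x : ℝ, x = Dinc₁ * (1 + Dinc₁ * qb₀ + 4 * QH₀ + 2 * t₀₀ * p₀₀ * QH₀) := ⟨_, rfl⟩; obtain ⟨Bz₀, hBz₀⟩ : ∃ x : ℝ, x = 4 * exp 1 * φ₀₀ * t₀₀ * (1 + sC₀) := ⟨_, rfl⟩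
  -- the levels group
  obtain ⟨Z₁₁, hZ₁₁⟩ : ∃ x : ℝ, x = (81 * CJ₁) ^ 2 / 8 := ⟨_, rfl⟩; obtain ⟨i₂₁, hi₂₁⟩ : ∃ x : ℝ, x = 8 * 16 * Z₁₁ ^ 2 * A₁ * P₁ ^ 2 / P.Klam := ⟨_, rfl⟩
  obtain ⟨t₁₁, ht₁₁⟩ : ∃ x : ℝ, x = 4 * exp 4 * (2 * Cκ₁ * klE0) / (162 ^ 2 * CJ₁ ^ 2) := ⟨_, rfl⟩; obtain ⟨p₁₁, hp₁₁⟩ : ∃ x : ℝ, x = 162 ^ 2 * CJ₁ ^ 2 / (2 * Cκ₁ * klE0) := ⟨_, rfl⟩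
  obtain ⟨φ₁₁, hφ₁₁⟩ : ∃ x : ℝ, x = exp 1 * Cα₁ / (Cκ₁ * klE0) := ⟨_, rfl⟩; obtain ⟨QH₁, hQH₁⟩ : ∃ x : ℝ, x = Z₁₁ * qb₀ + 1 := ⟨_, rfl⟩
  obtain ⟨sC₁, hsC₁⟩ : ∃ x : ℝ, x = i₂₁ / (2 * (Z₁₁ * qb₀)) + 16 * ab₀ * QH₁ ^ 3 / (4 * (Z₁₁ * qb₀) ^ 2) + 16 * ab₀ * QH₁ / 4 := ⟨_, rfl⟩
  obtain ⟨Θ₁, hΘ₁⟩ : ∃ x : ℝ, x = exp 1 ^ 2 * φ₁₁ * t₁₁ ^ 2 * i₂₁ + exp 1 ^ 3 * φ₁₁ * t₁₁ ^ 3 * (16 * ab₀ * QH₁ ^ 3) +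
    exp 1 ^ 3 * φ₁₁ * t₁₁ ^ 3 * (16 * ab₀) * QH₁ ^ 3 := ⟨_, rfl⟩
  obtain ⟨uf₁, huf₁⟩ : ∃ x : ℝ, x = min 1 (min (1 / (8 * (2 * Cκ₁ * klE0 / (162 ^ 2 * CJ₁ ^ 2)) * QH₁ + 1))
    (min (1 / (2 * exp 1 * t₁₁ * QH₁ + 1)) (1 / (4 * Θ₁ + 1)))) := ⟨_, rfl⟩
  obtain ⟨aT₀l, haT₀l⟩ : ∃ x : ℝ, x = Cinc₂ * (ab₀ + 16 * ab₀ + exp 1 * φ₁₁ * t₁₁ * (1 + sC₁) ^ 2 / (Z₁₁ * qb₀)) := ⟨_, rfl⟩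
  obtain ⟨qT₀l, hqT₀l⟩ : ∃ x : ℝ, x = Dinc₂ * (1 + Dinc₂ * qb₀ + 4 * QH₁ + 2 * t₁₁ * p₁₁ * QH₁) / 4 := ⟨_, rfl⟩; obtain ⟨Bz₁, hBz₁⟩ : ∃ x : ℝ, x = 4 * exp 1 * φ₁₁ * t₁₁ * (1 + sC₁) := ⟨_, rfl⟩
  -- the Z-thread (plain pins)
  obtain ⟨abz, habz⟩ : ∃ x : ℝ, x = A₁' / (2 * P.Klam ^ 2) := ⟨_, rfl⟩; obtain ⟨qbz, hqbz⟩ : ∃ x : ℝ, x = 4 * P₁' := ⟨_, rfl⟩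
  obtain ⟨Wz₀, hWz₀⟩ : ∃ x : ℝ, x = 32 * (27 : ℝ) ^ 4 * exp 2 := ⟨_, rfl⟩; obtain ⟨Zz₀, hZz₀⟩ : ∃ x : ℝ, x = exp 4 * (81 * CJz) ^ 2 / 8 := ⟨_, rfl⟩
  obtain ⟨i₂z, hi₂z⟩ : ∃ x : ℝ, x = 8 * (27 : ℝ) ^ 5 * Wz₀ * Zz₀ ^ 2 * A₁' * P₁' ^ 2 / P.Klam := ⟨_, rfl⟩
  obtain ⟨tz, htz⟩ : ∃ x : ℝ, x = exp 2 * (2 * Cκz * klE0) / (162 ^ 2 * CJz ^ 2) := ⟨_, rfl⟩; obtain ⟨pz, hpz⟩ : ∃ x : ℝ, x = exp 4 * 162 ^ 2 * CJz ^ 2 / (2 * Cκz * klE0) := ⟨_, rfl⟩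
  obtain ⟨φz, hφz⟩ : ∃ x : ℝ, x = 9 * Cbz * (4 : ℝ) ^ d / ((27 : ℝ) ^ 5 * exp 1 * Cκz * klE0 ^ 2) := ⟨_, rfl⟩; obtain ⟨QHz, hQHz⟩ : ∃ x : ℝ, x = Zz₀ * qbz + 1 := ⟨_, rfl⟩
  obtain ⟨aPz, haPz⟩ : ∃ x : ℝ, x = (27 : ℝ) ^ 5 * Wz₀ * abz := ⟨_, rfl⟩
  obtain ⟨sCz, hsCz⟩ : ∃ x : ℝ, x = i₂z / (2 * (Zz₀ * qbz)) + aPz * QHz ^ 3 / (4 * (Zz₀ * qbz) ^ 2) + aPz * QHz / 4 := ⟨_, rfl⟩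
  obtain ⟨Θz, hΘz⟩ : ∃ x : ℝ, x = exp 1 ^ 2 * φz * tz ^ 2 * i₂z + exp 1 ^ 3 * φz * tz ^ 3 * (aPz * QHz ^ 3) + exp 1 ^ 3 * φz * tz ^ 3 * aPz * QHz ^ 3 :=
    ⟨_, rfl⟩
  obtain ⟨ufz, hufz⟩ : ∃ x : ℝ, x = min 1 (min (1 / (8 * (2 * Cκz * klE0 / (exp 4 * 162 ^ 2 * CJz ^ 2)) * QHz + 1))
    (min (1 / (2 * exp 1 * tz * QHz + 1)) (1 / (4 * Θz + 1)))) := ⟨_, rfl⟩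
  obtain ⟨Bzz, hBzz⟩ : ∃ x : ℝ, x = 4 * exp 1 * φz * tz * (1 + sCz) := ⟨_, rfl⟩
  -- the main tower (`levNumerics_packageWN`'s closed forms at the max-dominants; E1's four- and six-leg shapes through `s₄ s₆`)
  obtain ⟨pZ, hpZ⟩ : ∃ x : ℝ, x = (81 * CJm) ^ 2 / 8 := ⟨_, rfl⟩; obtain ⟨pt, hpt⟩ : ∃ x : ℝ, x = 4 * exp 4 * (2 * Cκm * klE0) / (162 ^ 2 * CJm ^ 2) := ⟨_, rfl⟩
  obtain ⟨pp, hpp⟩ : ∃ x : ℝ, x = 162 ^ 2 * CJm ^ 2 / (2 * Cκm * klE0) := ⟨_, rfl⟩; obtain ⟨pφ, hpφ⟩ : ∃ x : ℝ, x = exp 1 * (Cbm * (4 : ℝ) ^ d / klE0) / (Cκm * klE0) := ⟨_, rfl⟩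
  obtain ⟨pκ, hpκ⟩ : ∃ x : ℝ, x = 16 * ((C₁ / C₂) * (8 : ℝ) ^ (d - 1)) := ⟨_, rfl⟩; obtain ⟨K₁, hK₁⟩ : ∃ x : ℝ, x = 16 * pφ * pt := ⟨_, rfl⟩
  obtain ⟨K₂, hK₂⟩ : ∃ x : ℝ, x = 256 * exp 1 * pp ^ 3 * pt ^ 4 * pφ * pκ / ((1 - ((2 : ℝ) ^ d)⁻¹) * (8 * exp 4) ^ 3) := ⟨_, rfl⟩; obtain ⟨Kx, hKx⟩ : ∃ x : ℝ, x = max K₁ K₂ := ⟨_, rfl⟩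
  obtain ⟨gmax, hgmax⟩ : ∃ x : ℝ, x = min 1 (min (1 / Kx) (1 / (4 * exp 1 * pφ * pt))) := ⟨_, rfl⟩; obtain ⟨i₂m, hi₂m⟩ : ∃ x : ℝ, x = 16 * 16 * pZ ^ 2 * klThinCountC * CWi ^ 4 * s₄ := ⟨_, rfl⟩
  obtain ⟨x₆m, hx₆m⟩ : ∃ x : ℝ, x = 16 * pZ ^ 3 * (512 * S₆ + aT₁g * qT₁g ^ 3) := ⟨_, rfl⟩; obtain ⟨q₀₀, hq₀₀⟩ : ∃ x : ℝ, x = 1 + (i₂m + x₆m) * Kx := ⟨_, rfl⟩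
  obtain ⟨QH, hQH⟩ : ∃ x : ℝ, x = pZ * qT₁g + q₀₀ + 1 := ⟨_, rfl⟩; obtain ⟨BfW, hBfW⟩ : ∃ x : ℝ, x = (16 + pκ) * aT₁g * QH * Kx := ⟨_, rfl⟩
  obtain ⟨Bf, hBf⟩ : ∃ x : ℝ, x = max (max 1 BfW) (max Bz₀ (max Bz₁ Bzz)) := ⟨_, rfl⟩
  obtain ⟨yP, hyP⟩ : ∃ x : ℝ, x = i₂m / (2 * q₀₀) + x₆m / (4 * q₀₀ ^ 2) + (16 + pκ) * aT₁g * QH / (2 * Bf ^ 2) + gmax := ⟨_, rfl⟩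
  obtain ⟨aP, haP⟩ : ∃ x : ℝ, x = (16 + pκ) * aT₁g / Bf ^ 2 + 2 * yP / q₀₀ := ⟨_, rfl⟩; obtain ⟨aA, haA⟩ : ∃ x : ℝ, x = 2 * yP / (pκ * q₀₀) := ⟨_, rfl⟩
  obtain ⟨aL, haL⟩ : ∃ x : ℝ, x = 3 * ((16 + pκ) * aT₁g * q₀₀ / (2 * Bf ^ 2)) / (2 * pκ * QH) := ⟨_, rfl⟩; obtain ⟨i₃g, hi₃g⟩ : ∃ x : ℝ, x = x₆m + aP * QH ^ 3 := ⟨_, rfl⟩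
  obtain ⟨sC, hsC⟩ : ∃ x : ℝ, x = i₂m / (2 * q₀₀) + i₃g / (4 * q₀₀ ^ 2) + aP * QH / 4 := ⟨_, rfl⟩
  obtain ⟨Sfive, hSfive⟩ : ∃ x : ℝ, x = exp 1 * pφ * pt * 0 + exp 1 ^ 2 * pφ * pt ^ 2 * (i₂m + 2 * QH * gmax) + exp 1 ^ 3 * pφ * pt ^ 3 * i₃g +
    pφ * aP * exp 1 ^ 2 * pt ^ 2 * QH ^ 2 / 2 := ⟨_, rfl⟩
  obtain ⟨Θm, hΘm⟩ : ∃ x : ℝ, x = exp 1 ^ 2 * pφ * pt ^ 2 * i₂m + exp 1 ^ 3 * pφ * pt ^ 3 * x₆m + exp 1 ^ 3 * pφ * pt ^ 3 * aP * QH ^ 3 := ⟨_, rfl⟩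
  obtain ⟨ufm, hufm⟩ : ∃ x : ℝ, x = min 1 (min (1 / (8 * (2 * Cκm * klE0 / (162 ^ 2 * CJm ^ 2)) * QH + 1)) (min (1 / (2 * exp 1 * pt * QH + 1))
    (min (1 / (2 * Sfive + 1)) (min (1 / (1024 * (2 * Cκm * klE0 / (162 ^ 2 * CJm ^ 2)) * aP * QH / (aL * (8 * exp 4) ^ 3) + 1)) (1 / (4 * Θm + 1)))))) :=
    ⟨_, rfl⟩
  obtain ⟨qT, hqT⟩ : ∃ x : ℝ, x = max 1 (C₂i ^ 2) * (1 + C₂r ^ 2 * (8 * exp 4 * QH + qT₁g) + 4 * QH + 2 * pt * pp * QH) / 4 := ⟨_, rfl⟩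
  obtain ⟨aT, haT⟩ : ∃ x : ℝ, x = C₁r / C₂r * (aT₁g / Bf ^ 2 + aA) + C₁i / C₂i * (aP + exp 1 * (gmax + sC) / (2 * q₀₀)) := ⟨_, rfl⟩
  obtain ⟨CEfm, hCEfm⟩ : ∃ x : ℝ, x = qT * Bf * max 1 (2 * aT) := ⟨_, rfl⟩; obtain ⟨CEf₁, hCEf₁⟩ : ∃ x : ℝ, x = qT₀l * Bf * max 1 (2 * aT₀l) := ⟨_, rfl⟩
  obtain ⟨ug₀, hug₀⟩ : ∃ x : ℝ, x = 1 / (4 * 16 * Z₀₀ * T₁ * 1 * Bf + 1) := ⟨_, rfl⟩; obtain ⟨ug₁, hug₁⟩ : ∃ x : ℝ, x = 1 / (4 * 16 * Z₁₁ * T₁ * ((d : ℝ) + 1) * Bf + 1) := ⟨_, rfl⟩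
  obtain ⟨ugz, hugz⟩ : ∃ x : ℝ, x = 1 / (4 * (27 : ℝ) ^ 5 * Wz₀ * Zz₀ * T₁' * Bf + 1) := ⟨_, rfl⟩; obtain ⟨s₂m, hs₂m⟩ : ∃ x : ℝ, x = gmax / (32 * pZ + 1) := ⟨_, rfl⟩
  -- §B the four packages
  have hBf1 : 1 ≤ Bf := by rw [hBf]; exact (le_max_left _ _).trans (le_max_left _ _)
  have hBf0 : 0 < Bf := lt_of_lt_of_le one_pos hBf1
  have hBfWle : max 1 BfW ≤ Bf := by rw [hBf]; exact le_max_left _ _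
  have hBz₀le : Bz₀ ≤ Bf := by rw [hBf]; exact (le_max_left _ _).trans (le_max_right _ _)
  have hBz₁le : Bz₁ ≤ Bf := by rw [hBf]; exact ((le_max_left _ _).trans (le_max_right _ _)).trans (le_max_right _ _)
  have hBzzle : Bzz ≤ Bf := by rw [hBf]; exact ((le_max_right _ _).trans (le_max_right _ _)).trans (le_max_right _ _)
  obtain ⟨huf₀0, haT₁g0, hqT₁g0, -, hug₀0, hG0⟩ := levNumW_group (Cinc₀ := 1) (Dinc₀ := 1) (κ := 1) (W₀₀ := 16) one_pos le_rfl hCinc₁ hDinc₁ hCκ₀ hCα hCJ₀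
    hA₁ hP₁ hT₁ hK1 le_rfl hab₀ hqb₀ rfl hZ₀₀ hi₂₀ rfl ht₀₀ hp₀₀ hφ₀₀ rfl hQH₀ rfl hsC₀ hΘ₀ huf₀ rfl haT₁g rfl hqT₁g rfl hug₀ hBf1
    (by rw [← hBz₀]; exact hBz₀le)
  obtain ⟨huf₁0, -, -, hCEf₁0, hug₁0, hG1⟩ := levNumW_group (Cinc₁ := 1) (Dinc₁ := 1) (κ := (d : ℝ) + 1) (W₀₀ := 16) (lt_of_lt_of_le one_pos hCinc₂) hDinc₂
    le_rfl le_rfl hCκ₁ hCα₁ hCJ₁ hA₁ hP₁ hT₁ hK1 hd1 hab₀ hqb₀ rfl hZ₁₁ hi₂₁ rfl ht₁₁ hp₁₁ hφ₁₁ rfl hQH₁ rfl hsC₁ hΘ₁ huf₁ haT₀l rfl hqT₀l rfl hCEf₁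
    hug₁ hBf1 (by rw [← hBz₁]; exact hBz₁le)
  obtain ⟨hufz0, hugz0, hZg⟩ := levNum_zguard hCκz hCbz hCJz hA₁' hP₁' hT₁' hK1 habz hqbz hWz₀ hZz₀ hi₂z rfl htz hpz hφz rfl hQHz haPz hsCz hΘz hufz
    rfl rfl rfl rfl rfl hugz hBf1 (by rw [← hBzz]; exact hBzzle)
  have hrG1 : ((2 : ℝ) ^ d)⁻¹ < 1 := inv_lt_one_of_one_lt₀ (one_lt_pow₀ (by norm_num) (by omega))
  have hrG0 : 0 < 1 - ((2 : ℝ) ^ d)⁻¹ := sub_pos.2 hrG1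
  have hpZ0 : 0 < pZ := by rw [hpZ]; positivity
  have hi₂m0 : 0 ≤ i₂m := by rw [hi₂m]; have := klThinCountC_pos; positivity
  have hx₆m0 : 0 ≤ x₆m := by rw [hx₆m]; positivity
  obtain ⟨hufm0, hCEfm0, -, hg0, hWN⟩ := levNumerics_packageWN (Cinc := C₁i / C₂i) (Dinc := max 1 (C₂i ^ 2)) (pW := 16) (pρ := 8 * exp 4)
    hC₁ hC₂ hC₁r hC₂r (div_pos hC₁i hC₂i) (le_max_left _ _) hCκm0 hCbm0 hCJm0 hd haT₁g0 hqT₁g0 hi₂m0 hx₆m0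
    rfl hpZ rfl hpt hpp hpφ rfl hpκ hK₁ hK₂ hKx hgmax hq₀₀ hQH hBfW hBfWle rfl hyP rfl haP haA haL hi₃g rfl hsC hSfive rfl hΘm hufm hqT haT hCEfm (by rw [hpZ]; exact hblkW)
  -- the outputs
  obtain ⟨uf, huf⟩ : ∃ x : ℝ, x = min ufm (min uf₀ (min uf₁ ufz)) := ⟨_, rfl⟩; obtain ⟨ug, hug⟩ : ∃ x : ℝ, x = min ug₀ (min ug₁ ugz) := ⟨_, rfl⟩
  obtain ⟨CEf, hCEf⟩ : ∃ x : ℝ, x = max (max CEfm CEf₁) (max 1 (max (C₆c * 16 * S₆) (2 * klThinCountC * CW₄ ^ 4 * t₄))) := ⟨_, rfl⟩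
  have huf0 : 0 < uf := by rw [huf]; exact lt_min hufm0 (lt_min huf₀0 (lt_min huf₁0 hufz0))
  obtain ⟨hufm_le, huf₀_le, huf₁_le, hufz_le⟩ : uf ≤ ufm ∧ uf ≤ uf₀ ∧ uf ≤ uf₁ ∧ uf ≤ ufz := by
    refine ⟨?_, ?_, ?_, ?_⟩ <;> rw [huf] <;> simp only [min_le_iff, le_refl, true_or, or_true]
  have hug0 : 0 < ug := by rw [hug]; exact lt_min hug₀0 (lt_min hug₁0 hugz0)
  have hCEf0 : 0 ≤ CEf := by rw [hCEf]; exact le_max_of_le_left (le_max_of_le_left hCEfm0)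
  have hs₂m0 : 0 < s₂m := by rw [hs₂m]; positivity
  refine ⟨Bf, uf, CEf, ug, s₂m, hBf1, huf0, hCEf0, hug0, hs₂m0, ?_⟩
  -- §C the binders
  intro G Q c hc hc6 hc₃' hcc₀ hcug μ hμ U hU hU9 hU₀' hUU₁ hcU hUuf hUd hUug β hβmin hβc L M _ _ hL3 hM3 n hn1 hnN hkl hhist hosc hccuf
    S₂ hS₂0 hS₂m hS₂ hS₄ hC6in Qe hCE hQe hL4 j hjn
  have hCEfmle : CEfm ≤ Qe.CE := ((le_max_left _ _).trans (le_max_left _ _)).trans ((le_of_eq hCEf.symm).trans hCE)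
  have hCEf₁le : CEf₁ ≤ Qe.CE := ((le_max_right _ _).trans (le_max_left _ _)).trans ((le_of_eq hCEf.symm).trans hCE)
  have hCE1 : (1 : ℝ) ≤ Qe.CE := ((le_max_left _ _).trans (le_max_right _ _)).trans ((le_of_eq hCEf.symm).trans hCE)
  have hT6 : C₆c * 16 * S₆ ≤ Qe.CE ^ 3 :=
    ((((le_max_left _ _).trans (le_max_right _ _)).trans (le_max_right _ _)).trans ((le_of_eq hCEf.symm).trans hCE)).trans
      (le_self_pow₀ hCE1 (by norm_num))
  have hth4 : 2 * klThinCountC * CW₄ ^ 4 * t₄ ≤ Qe.CE ^ 2 :=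
    ((((le_max_right _ _).trans (le_max_right _ _)).trans (le_max_right _ _)).trans ((le_of_eq hCEf.symm).trans hCE)).trans
      (le_self_pow₀ hCE1 (by norm_num))
  have hS₄0' : ∀ j, 0 ≤ epsCoupling P U j := fun j => by unfold epsCoupling; positivity
  have hS₄0 : ∀ j, 0 ≤ t₄ * epsCoupling P U j := fun j => mul_nonneg ht₄ (hS₄0' j)
  have hT4 : ∀ j, 1 ≤ j → j ≤ n → klThinCountC * sectorCount j * (CW₄ ^ 4 * (t₄ * epsCoupling P U j)) ≤ klWtBudget P Qe U j 4 := by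
    intro j _ _
    rw [klWtBudget_four, zpow_natCast, show (sectorCount j : ℝ) = 2 * (2 : ℝ) ^ j by unfold sectorCount; push_cast; ring]
    calc klThinCountC * (2 * (2 : ℝ) ^ j) * (CW₄ ^ 4 * (t₄ * epsCoupling P U j)) = (2 * klThinCountC * CW₄ ^ 4 * t₄) * (epsCoupling P U j * (2 : ℝ) ^ j) := by ring
      _ ≤ Qe.CE ^ 2 * (epsCoupling P U j * (2 : ℝ) ^ j) := mul_le_mul_of_nonneg_right hth4 (mul_nonneg (hS₄0' j) (by positivity))
      _ = Qe.CE ^ 2 * epsCoupling P U j * (2 : ℝ) ^ j := by ring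
  obtain ⟨hcc₀a, hcc₀w, hcc₀p⟩ : c ≤ c₀ ∧ c ≤ c₀w ∧ c ≤ c₀p := by simp only [le_min_iff] at hcc₀; exact ⟨hcc₀.1, hcc₀.2.1, hcc₀.2.2⟩
  obtain ⟨hUU₁a, hUU₁w, hUU₁p⟩ : U ≤ U₁ ∧ U ≤ U₀w ∧ U ≤ U₀p := by simp only [le_min_iff] at hUU₁; exact ⟨hUU₁.1, hUU₁.2.1, hUU₁.2.2⟩
  obtain ⟨hUug₀, hUug₁, hUugz⟩ : U ≤ ug₀ ∧ U ≤ ug₁ ∧ U ≤ ugz := by rw [hug] at hUug; simp only [le_min_iff] at hUug; exact ⟨hUug.1, hUug.2.1, hUug.2.2⟩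
  obtain ⟨hcug₀, hcug₁, hcugz⟩ : c ≤ ug₀ ∧ c ≤ ug₁ ∧ c ≤ ugz := by rw [hug] at hcug; simp only [le_min_iff] at hcug; exact ⟨hcug.1, hcug.2.1, hcug.2.2⟩
  have hβ : 0 < β := KLRegimeSplit.pos_of_klBetaMin_le hβmin
  have hM0 : (0 : ℝ) < M := Nat.cast_pos.2 (Nat.pos_of_ne_zero (NeZero.ne M)); have hβM : β ≤ M := beta_le_of_klEngM₃_le hM3; have hKl : 0 ≤ P.Klam := hK0.le
  have hZ₀₀0 : 0 < Z₀₀ := by rw [hZ₀₀]; positivity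
  have hU1 : U ≤ 1 := by
    have hX : 0 ≤ 4 * 16 * Z₀₀ * T₁ * 1 * Bf := by positivity
    refine hUug₀.trans ?_; rw [hug₀, div_le_one (by positivity)]; linarith
  have hεmono : ∀ j, 1 ≤ j → Bf * epsCoupling P U 1 ≤ Bf * epsCoupling P U j := by
    intro j hj; unfold epsCoupling; have : ((1 : ℕ) : ℝ) ≤ (j : ℝ) := Nat.cast_le.2 hj; gcongr
  obtain ⟨hl0, hlam, hlamd, hlow, hεle, hl1⟩ := levNum_couplings hK1 hU hBf1 huf0 hUuf hUd hkl hccuf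
  have hfr : FrameOK R U (nScales β) μ (klFlowFrameU L M β U μ n) := frameOK_klFlowFrameU_of_histP_le hR2 hn1 le_rfl hnN hhist
  set K : TrigPolyC4v := klFlowFrameU L M β U μ n with hKdef
  obtain ⟨D, hD3, hDi, hcard⟩ := exists_degreeCap_all L M n
  have hDall : ∀ k, 1 ≤ k → d * k ≤ n → Fintype.card (SpaceTimeIdx L M × SectorLeg (sectorCount (d * k - 1))) / 2 ≤ D :=
    fun k _ hk => hDi (d * k - 1) (by omega)
  have hD0 : Fintype.card (SpaceTimeIdx L M × SectorLeg (sectorCount 0)) / 2 ≤ D := hDi 0 (Nat.zero_le _)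
  have hdat := fun jr => hdatW c hc hcc₀w μ hμ U hU hU9 hUU₁w β hβmin hβc L M hL3 hM3 K hfr jr
  -- §D block 0: the datum names, the base group at `λ_d`
  obtain ⟨Ab₀, hAb₀⟩ : ∃ x : ℝ, x = A₁ * imagTimeWeight β M / P.Klam ^ 2 / Bf ^ 2 := ⟨_, rfl⟩; obtain ⟨Qb₀, hQb₀⟩ : ∃ x : ℝ, x = P₁ / imagTimeWeight β M ^ 2 := ⟨_, rfl⟩
  have hAb₀0 : 0 ≤ Ab₀ := by rw [hAb₀]; have := imagTimeWeight_nonneg hβ.le M; positivity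
  have hQb₀0 : 0 ≤ Qb₀ := by rw [hQb₀]; positivity
  have hlawb₀ : ∀ j j', 1 ≤ j → j ≤ n → ∀ p : ℕ, 3 ≤ p →
      klTowerMeasWtAt L M β U μ K 1 1 j (2 * p) / klLevUnitF β M 0 p 0 ≤ Ab₀ * (Bf * epsCoupling P U j') ^ (p - 1) * Qb₀ ^ p := by
    intro j j' _ _ p hp; rw [hAb₀, hQb₀]; exact (hdat j).1 Bf hBf1 j' p hp
  obtain ⟨κb₀, hκb₀⟩ : ∃ x : ℝ, x = Real.sqrt (2 * Cκ₀ * klE0) := ⟨_, rfl⟩; obtain ⟨αb₀, hαb₀⟩ : ∃ x : ℝ, x = Cα * ((M : ℝ) / β) := ⟨_, rfl⟩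
  obtain ⟨crb₀, hcrb₀⟩ : ∃ x : ℝ, x = 81 * CJ₀ * M / β := ⟨_, rfl⟩; obtain ⟨ccb₀, hccb₀⟩ : ∃ x : ℝ, x = 162 * CJ₀ * M / β := ⟨_, rfl⟩
  obtain ⟨W₀, hW₀⟩ : ∃ x : ℝ, x = 32 * crb₀ / ccb₀ := ⟨_, rfl⟩; obtain ⟨Z₀, hZ₀⟩ : ∃ x : ℝ, x = imagTimeWeight β M ^ 2 * ccb₀ ^ 2 / 8 := ⟨_, rfl⟩
  obtain ⟨τ₀, hτ₀⟩ : ∃ x : ℝ, x = 4 * exp 4 * κb₀ ^ 2 / ccb₀ ^ 2 := ⟨_, rfl⟩; obtain ⟨Φ₀, hΦ₀⟩ : ∃ x : ℝ, x = exp 1 * αb₀ * ccb₀ / (κb₀ ^ 2 * crb₀) := ⟨_, rfl⟩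
  have hκb₀0 : 0 < κb₀ := by rw [hκb₀]; exact Real.sqrt_pos.2 (by positivity)
  have hcrb₀0 : 0 < crb₀ := (by rw [hcrb₀]; positivity); have hccb₀0 : 0 < ccb₀ := (by rw [hccb₀]; positivity)
  have hW₀0 : 0 ≤ W₀ := (by rw [hW₀]; positivity); have hZ₀0 : 0 ≤ Z₀ := (by rw [hZ₀]; positivity)
  have hτ₀0 : 0 ≤ τ₀ := by rw [hτ₀]; positivity
  have hΦ₀0 : 0 ≤ Φ₀ := by rw [hΦ₀, hαb₀]; positivity
  set ld : ℝ := Bf * epsCoupling P U d with hld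
  obtain ⟨ι₁₀, hι₁₀⟩ : ∃ x : ℝ, x = W₀ * Z₀ ^ 1 * (T₁ * (|U| + c) / imagTimeWeight β M) / ld := ⟨_, rfl⟩
  obtain ⟨ι₂₀, hι₂₀⟩ : ∃ x : ℝ, x = W₀ * Z₀ ^ 2 * (A₁ * P₁ ^ 2 * |U| / imagTimeWeight β M ^ 3) / ld := ⟨_, rfl⟩
  have hG0' := hG0 β M hβ hβM U c hU hU1 hc hUug₀ hcug₀ Ab₀ Qb₀ hAb₀ hQb₀ αb₀ κb₀ crb₀ ccb₀ W₀ Z₀ (κb₀ ^ 2 / ccb₀ ^ 2) τ₀ (ccb₀ ^ 2 / κb₀ ^ 2) Φ₀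
    hαb₀ hκb₀ hcrb₀ hccb₀ hW₀ hZ₀ rfl hτ₀ rfl hΦ₀ ld ld (hlow d) le_rfl (by rw [one_mul]) (hlamd.trans huf₀_le)
    (W₀ * Ab₀) (Z₀ * Qb₀ + 1) ι₁₀ ι₂₀ (W₀ * Ab₀ * (Z₀ * Qb₀ + 1) ^ 3) rfl rfl hι₁₀ hι₂₀ rfl
  obtain ⟨⟨hA'₀0, hQ'₀0, hdA₀, hdQ₀, hdι₀⟩, ⟨hi1, hi2, hx1, hx2, hx3, hy0, hθ0⟩, hνpack, -, hdom⟩ := hG0'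
  obtain ⟨hν3, hν1, hν2, hguard0⟩ := hνpack _ rfl
  have hkit0 := fun j (hjd : d ≤ j) (hjn : j ≤ n) =>
    kitRowsWt_of_unitLaw (D := D) (μ := fun m => klTowerMeasWtAt L M β U μ K 1 1 j (2 * m) / klLevUnitF β M 0 m 0) hW₀0 hZ₀0 hτ₀0 hΦ₀0 hAb₀0 hQb₀0
      (hl0 d) (fun m hm => hlawb₀ j d (by omega) hjn m hm) (hdat j).2.1 (hdat j).2.2 hdA₀ hdQ₀ hdι₀ hi1 hi2 hν3 hν1 hν2 (hguard0 D)
  set Qtot₁ : ℝ := Dinc₁ * max 1 (max (Dinc₁ * Qb₀) (max (4 * (Z₀ * Qb₀ + 1)) (2 * τ₀ * (ccb₀ ^ 2 / κb₀ ^ 2) * (Z₀ * Qb₀ + 1)))) with hQtot₁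
  obtain ⟨hAtot₁le, hQtot₁le⟩ := hdom (Cinc₁ * Ab₀) (Dinc₁ * Qb₀) Qtot₁ _ rfl rfl rfl rfl
  -- the main tower's base amplitudes: `Ab := aT₁·(β/M)/Bf²`, `Qb := Qtot₁`
  obtain ⟨Ab, hAb⟩ : ∃ x : ℝ, x = aT₁g * (β / M) / Bf ^ 2 := ⟨_, rfl⟩
  have hAb0 : 0 ≤ Ab := by rw [hAb]; positivity
  have hQtot₁0 : 0 ≤ Qtot₁ := mul_nonneg (by linarith) (le_trans zero_le_one (le_max_left _ _))
  -- §E block 0's Z-thread: the plain datum's majorants at `λ_1` and the plain guard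
  obtain ⟨κz, hκz⟩ : ∃ x : ℝ, x = Real.sqrt (2 * Cκz * klE0) := ⟨_, rfl⟩; obtain ⟨αz, hαz⟩ : ∃ x : ℝ, x = Cbz * ((M : ℝ) / β) * (4 : ℝ) ^ d / klE0 := ⟨_, rfl⟩
  obtain ⟨crz, hcrz⟩ : ∃ x : ℝ, x = 81 * CJz * M / β := ⟨_, rfl⟩; obtain ⟨ccz, hccz⟩ : ∃ x : ℝ, x = 162 * CJz * M / β := ⟨_, rfl⟩
  obtain ⟨hνz1, hνz2, hνz3, hguardZ⟩ := hZg β M hβ hβM U c hU hU1 hc hUugz hcugz κz αz crz ccz hκz hαz hcrz hccz (Bf * epsCoupling P U 1)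
    (hlow 1) ((hlam 1 hn1).trans hufz_le) _ rfl
  have hguardz : d ≤ n → 9 * αz * ccz / ((27 : ℝ) ^ 5 * exp 1 * κz ^ 2 * crz) * towerV D (exp 2 * κz ^ 2 / ccz ^ 2)
      (fun m => 64 * (27 : ℝ) ^ 4 * exp 2 * crz / ccz * (exp 4 * ccz ^ 2 * imagTimeWeight β M ^ 2 / 8) ^ m * klTowerMuLevF L M β U μ K 1 1 m) < 1 := by
    intro _
    obtain ⟨-, hm1, hm2, hm3⟩ := hdatP c hc hcc₀p μ hμ U hU hU9 hUU₁p β hβmin hβc L M hL3 hM3 K hfr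
    have hκz0 : 0 < κz := by rw [hκz]; exact Real.sqrt_pos.2 (by positivity)
    have hcrz0 : 0 < crz := by rw [hcrz]; positivity
    have hccz0 : 0 < ccz := by rw [hccz]; positivity
    have hαz0 : 0 ≤ αz := by rw [hαz]; positivity
    refine lt_of_le_of_lt (mul_le_mul_of_nonneg_left (towerV_mono_Icc (by positivity) fun m hm1' _ => ?_) (by positivity)) (hguardZ D)
    refine mul_le_mul_of_nonneg_left ?_ (by positivity)
    rcases Nat.lt_or_ge m 3 with hm | hm
    · interval_cases m
      · exact hm1.trans hνz1
      · exact hm2.trans hνz2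
    · exact (hm3 Bf hBf1 1 m hm).trans (hνz3 m hm)
  -- §F block 0's levels group (`1 ≤ j ≤ d − 1`, slots at `λ_1`, rows at `λ_j ≤ (d+1)λ_1`)
  obtain ⟨κb₁, hκb₁⟩ : ∃ x : ℝ, x = Real.sqrt (2 * Cκ₁ * klE0) := ⟨_, rfl⟩; obtain ⟨αb₁, hαb₁⟩ : ∃ x : ℝ, x = Cα₁ * ((M : ℝ) / β) := ⟨_, rfl⟩
  obtain ⟨crb₁, hcrb₁⟩ : ∃ x : ℝ, x = 81 * CJ₁ * M / β := ⟨_, rfl⟩; obtain ⟨ccb₁, hccb₁⟩ : ∃ x : ℝ, x = 162 * CJ₁ * M / β := ⟨_, rfl⟩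
  obtain ⟨W₁, hW₁⟩ : ∃ x : ℝ, x = 32 * crb₁ / ccb₁ := ⟨_, rfl⟩; obtain ⟨Z₁, hZ₁⟩ : ∃ x : ℝ, x = imagTimeWeight β M ^ 2 * ccb₁ ^ 2 / 8 := ⟨_, rfl⟩
  obtain ⟨τ₁, hτ₁⟩ : ∃ x : ℝ, x = 4 * exp 4 * κb₁ ^ 2 / ccb₁ ^ 2 := ⟨_, rfl⟩; obtain ⟨Φ₁, hΦ₁⟩ : ∃ x : ℝ, x = exp 1 * αb₁ * ccb₁ / (κb₁ ^ 2 * crb₁) := ⟨_, rfl⟩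
  have hκb₁0 : 0 < κb₁ := by rw [hκb₁]; exact Real.sqrt_pos.2 (by positivity)
  have hcrb₁0 : 0 < crb₁ := (by rw [hcrb₁]; positivity); have hccb₁0 : 0 < ccb₁ := (by rw [hccb₁]; positivity)
  have hW₁0 : 0 ≤ W₁ := (by rw [hW₁]; positivity); have hZ₁0 : 0 ≤ Z₁ := (by rw [hZ₁]; positivity)
  have hτ₁0 : 0 ≤ τ₁ := by rw [hτ₁]; positivity
  have hΦ₁0 : 0 ≤ Φ₁ := by rw [hΦ₁, hαb₁]; positivity
  set l1 : ℝ := Bf * epsCoupling P U 1 with hl1d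
  obtain ⟨ι₁₁, hι₁₁⟩ : ∃ x : ℝ, x = W₁ * Z₁ ^ 1 * (T₁ * (|U| + c) / imagTimeWeight β M) / l1 := ⟨_, rfl⟩
  obtain ⟨ι₂₁, hι₂₁⟩ : ∃ x : ℝ, x = W₁ * Z₁ ^ 2 * (A₁ * P₁ ^ 2 * |U| / imagTimeWeight β M ^ 3) / l1 := ⟨_, rfl⟩
  have hG1j := fun j (hj1 : 1 ≤ j) (hjd : j ≤ d) (hjn : j ≤ n) =>
    hG1 β M hβ hβM U c hU hU1 hc hUug₁ hcug₁ Ab₀ Qb₀ hAb₀ hQb₀ αb₁ κb₁ crb₁ ccb₁ W₁ Z₁ (κb₁ ^ 2 / ccb₁ ^ 2) τ₁ (ccb₁ ^ 2 / κb₁ ^ 2) Φ₁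
      hαb₁ hκb₁ hcrb₁ hccb₁ hW₁ hZ₁ rfl hτ₁ rfl hΦ₁ l1 (Bf * epsCoupling P U j) (hlow 1) (hεmono j hj1)
      (hεle j hjd) ((hlam j hjn).trans huf₁_le) (W₁ * Ab₀) (Z₁ * Qb₀ + 1) ι₁₁ ι₂₁ (W₁ * Ab₀ * (Z₁ * Qb₀ + 1) ^ 3) rfl rfl hι₁₁ hι₂₁ rfl
  have hA'₁0 : 0 ≤ W₁ * Ab₀ := by positivity
  have hQ'₁0 : 0 < Z₁ * Qb₀ + 1 := by positivity
  have hkit1 := fun j (hj1 : 1 ≤ j) (hjd : j ≤ d - 1) (hjn : j ≤ n) =>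
    kitRowsWt_of_unitLaw (D := D) (μ := fun m => klTowerMeasWtAt L M β U μ K 1 1 j (2 * m) / klLevUnitF β M 0 m 0) hW₁0 hZ₁0 hτ₁0 hΦ₁0 hAb₀0 hQb₀0
      (hl0 j) (fun m hm => hlawb₀ j j hj1 hjn m hm) (hdat j).2.1 (hdat j).2.2 (hG1j j hj1 (by omega) hjn).1.2.2.1 (hG1j j hj1 (by omega) hjn).1.2.2.2.1
      (hG1j j hj1 (by omega) hjn).1.2.2.2.2 (hG1j j hj1 (by omega) hjn).2.1.1 (hG1j j hj1 (by omega) hjn).2.1.2.1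
      ((hG1j j hj1 (by omega) hjn).2.2.1 _ rfl).1 ((hG1j j hj1 (by omega) hjn).2.2.1 _ rfl).2.1 ((hG1j j hj1 (by omega) hjn).2.2.1 _ rfl).2.2.1
      (((hG1j j hj1 (by omega) hjn).2.2.1 _ rfl).2.2.2 D)
  have hsm1 := fun j (hj1 : 1 ≤ j) (hjd : j ≤ d - 1) (hjn : j ≤ n) => (hG1j j hj1 (by omega) hjn).2.1.2.2
  set Qtot₂ : ℝ := Dinc₂ * max 1 (max (Dinc₂ * Qb₀) (max (4 * (Z₁ * Qb₀ + 1)) (2 * τ₁ * (ccb₁ ^ 2 / κb₁ ^ 2) * (Z₁ * Qb₀ + 1)))) with hQtot₂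
  -- §G the main tower: names at the max-dominants, pinned imports, the (I5) choices, `levNumerics_packageWN` at `(λ_j, ι₁ j)`
  obtain ⟨hκb, hαb, hcrb, hccb, hκbr, hαbr, hcrbr, hccbr⟩ := levPinW_dominants (Cκ := Cκ) (Cb := Cb) (CJ := CJ) (Cκr := Cκr) (Cbr := Cbr) (CJr := CJr)
    (M := M) (d := d) hβ
  obtain ⟨κb, hκbd⟩ : ∃ x : ℝ, x = Real.sqrt (2 * Cκm * klE0) := ⟨_, rfl⟩; obtain ⟨αb, hαbd⟩ : ∃ x : ℝ, x = Cbm * ((M : ℝ) / β) * (4 : ℝ) ^ d / klE0 := ⟨_, rfl⟩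
  obtain ⟨crb, hcrbd⟩ : ∃ x : ℝ, x = 81 * CJm * M / β := ⟨_, rfl⟩; obtain ⟨ccb, hccbd⟩ : ∃ x : ℝ, x = 162 * CJm * M / β := ⟨_, rfl⟩
  obtain ⟨W, hW⟩ : ∃ x : ℝ, x = 32 * crb / ccb := ⟨_, rfl⟩; obtain ⟨Z, hZ⟩ : ∃ x : ℝ, x = imagTimeWeight β M ^ 2 * ccb ^ 2 / 8 := ⟨_, rfl⟩
  obtain ⟨σ, hσ⟩ : ∃ x : ℝ, x = κb ^ 2 / ccb ^ 2 := ⟨_, rfl⟩; obtain ⟨τ, hτ⟩ : ∃ x : ℝ, x = 4 * exp 4 * κb ^ 2 / ccb ^ 2 := ⟨_, rfl⟩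
  obtain ⟨ψ, hψ⟩ : ∃ x : ℝ, x = ccb ^ 2 / κb ^ 2 := ⟨_, rfl⟩; obtain ⟨Φ, hΦ⟩ : ∃ x : ℝ, x = exp 1 * αb * ccb / (κb ^ 2 * crb) := ⟨_, rfl⟩
  have hW16 : W = 16 := levPinW_W hCJm0.ne' hβ.ne' hM0.ne' hcrbd hccbd hW
  have hZp : Z = pZ := by rw [hpZ]; exact levPinW_Z hβ.ne' hM0.ne' hccbd hZ
  obtain ⟨ι₂, hι₂⟩ : ∃ x : ℝ, x = i₂m * ((M : ℝ) / β) ^ 3 := ⟨_, rfl⟩; obtain ⟨ι₃, hι₃⟩ : ∃ x : ℝ, x = x₆m * ((M : ℝ) / β) ^ 5 := ⟨_, rfl⟩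
  -- the two dominations of the six-leg name `ι₃` (♯4 (ii)): the (C1′) cell amplitude `512·S₆·(M/β)⁵` and block 1's `Ab·Qb³`
  have hS₆e : 0 ≤ 512 * S₆ := by positivity
  have hdomS : 512 * W * Z ^ 3 * S₆ * ((M : ℝ) / β) ^ 5 ≤ ι₃ :=
    calc 512 * W * Z ^ 3 * S₆ * ((M : ℝ) / β) ^ 5 = W * Z ^ 3 * (512 * S₆ * ((M : ℝ) / β) ^ 5) := by ring
      _ ≤ ι₃ := levNumW_sixDom_import hW16 hZp hpZ0.le haT₁g0.le hqT₁g0.le hβ le_rfl hx₆m hι₃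
  have hdomAQ : W * Z ^ 3 * (Ab * Qtot₁ ^ 3) ≤ ι₃ := levNumW_sixDom_base hW16 hZp hpZ0.le hS₆e haT₁g0.le hβ hβM hBf1 hAb hQtot₁0 hQtot₁le hx₆m hι₃
  obtain ⟨κA, hκA⟩ : ∃ x : ℝ, x = W * ((C₁ / C₂) * (8 : ℝ) ^ (d - 1)) := ⟨_, rfl⟩; obtain ⟨Q'', hQ''⟩ : ∃ x : ℝ, x = Z * Qtot₁ + q₀₀ * ((M : ℝ) / β) ^ 2 + 1 := ⟨_, rfl⟩
  obtain ⟨ρ, hρ⟩ : ∃ x : ℝ, x = max 4 (2 * τ * ψ) := ⟨_, rfl⟩; obtain ⟨a, ha⟩ : ∃ x : ℝ, x = W * Ab + κA * Ab := ⟨_, rfl⟩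
  obtain ⟨Y, hY⟩ : ∃ x : ℝ, x = ι₂ / (2 * Q'') + W * Z ^ 3 * (ι₃ / (W * Z ^ 3)) / (4 * Q'' ^ 2) + a * Q'' / 2 + gmax * ((M : ℝ) / β) := ⟨_, rfl⟩
  obtain ⟨A, hA⟩ : ∃ x : ℝ, x = 2 * Y * (1 - ((2 : ℝ) ^ d)⁻¹) / (κA * Q'') := ⟨_, rfl⟩; obtain ⟨A', hA'⟩ : ∃ x : ℝ, x = a + 2 * Y / Q'' := ⟨_, rfl⟩
  obtain ⟨⟨hA0, hQpos, hQ''0, hA'0, hdm1, hdm2, hdm3, hdm4⟩, hrows, hCEp⟩ := hWN β M hβ hβM Ab Qtot₁ hAb hQtot₁0 hQtot₁le κb αb crb ccb hκbd hαbd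
    hcrbd hccbd W Z σ τ ψ Φ hW hZ hσ hτ hψ hΦ ι₂ ι₃ hι₂ hι₃ κA (q₀₀ * ((M : ℝ) / β) ^ 2) Q'' ρ (ρ * Q'') a (ι₃ / (W * Z ^ 3)) Y A A'
    hκA rfl hQ'' hρ rfl ha rfl hY hA hA'
  set i₁ : ℕ → ℝ := fun j => 2 * W * Z * (S₂ / (Bf * epsCoupling P U j)) with hi₁
  set ι₁ : ℕ → ℝ := fun j => i₁ j * ((M : ℝ) / β) with hι₁
  have hι₁0 : ∀ j, 0 ≤ ι₁ j := fun j => by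
    simp only [hι₁, hi₁]; rw [hW16, hZp]; have := hl0 j; positivity
  have hX0 : 0 ≤ 32 * pZ := by positivity
  have hs₂mg : 32 * pZ * s₂m ≤ gmax := by
    rw [hs₂m]
    calc 32 * pZ * (gmax / (32 * pZ + 1)) = gmax * (32 * pZ / (32 * pZ + 1)) := by ring
      _ ≤ gmax * 1 := mul_le_mul_of_nonneg_left ((div_le_one (by positivity)).2 (by linarith)) hg0.le
      _ = gmax := mul_one _
  have hprod : ∀ j, ι₁ j * (Bf * epsCoupling P U j) ≤ gmax * ((M : ℝ) / β) := by
    intro j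
    have hεj : 0 < epsCoupling P U j := by unfold epsCoupling; have := abs_pos.2 hU.ne'; positivity
    have heq : ι₁ j * (Bf * epsCoupling P U j) = 32 * pZ * S₂ * ((M : ℝ) / β) := by
      simp only [hι₁, hi₁]; rw [hW16, hZp]; field_simp; ring
    rw [heq]
    have h1 : 32 * pZ * S₂ ≤ 32 * pZ * s₂m := mul_le_mul_of_nonneg_left hS₂m hX0
    exact mul_le_mul_of_nonneg_right (h1.trans hs₂mg) (by positivity)
  have hι₂eq : ι₂ = 16 * W * Z ^ 2 * klThinCountC * CWi ^ 4 * s₄ * ((M : ℝ) / β) ^ 3 := by rw [hι₂, hi₂m, hW16, hZp]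
  have hnum := fun j (_ : d ≤ j) (hjn : j ≤ n) => hrows (Bf * epsCoupling P U j) (ι₁ j) (hl0 j) ((hlam j hjn).trans hufm_le) (hι₁0 j) (hprod j)
  -- §H the composition
  exact hall'' G Q c hc hc6 hc₃' hcc₀a μ hμ U hU hU9 hU₀' hUU₁a hcU β hβmin hβc L M hL3 hM3 n hn1 hnN hkl hhist hosc hd D hD3 hDall hcard hD0
    Bf A (ρ * Q'') Ab Qtot₁ hBf1 hA0 hQpos hAb0 hQtot₁0 Ab₀ Qb₀ hAb₀0 hQb₀0
    αb₀ κb₀ crb₀ ccb₀ W₀ Z₀ (κb₀ ^ 2 / ccb₀ ^ 2) τ₀ (ccb₀ ^ 2 / κb₀ ^ 2) Φ₀ hαb₀ hκb₀ hcrb₀ hccb₀ hW₀ hZ₀ rfl hτ₀ rfl hΦ₀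
    (W₀ * Ab₀) (Z₀ * Qb₀ + 1) ι₁₀ ι₂₀ (W₀ * Ab₀ * (Z₀ * Qb₀ + 1) ^ 3) hA'₀0 hQ'₀0 hlawb₀
    (fun j hjd hjn => ⟨(hkit0 j hjd hjn).1, (hkit0 j hjd hjn).2.1, (hkit0 j hjd hjn).2.2.1, (hkit0 j hjd hjn).2.2.2.1, hx1, hx2, hx3, hy0, hθ0,
      (hkit0 j hjd hjn).2.2.2.2⟩)
    (Cinc₁ * Ab₀) (Dinc₁ * Qb₀) Qtot₁ _ rfl rfl rfl rfl (fun _ => (le_of_eq hAb.symm).trans' hAtot₁le) rfl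
    κz αz crz ccz hκz hαz hcrz hccz hguardz
    αb₁ κb₁ crb₁ ccb₁ W₁ Z₁ (κb₁ ^ 2 / ccb₁ ^ 2) τ₁ (ccb₁ ^ 2 / κb₁ ^ 2) Φ₁ hαb₁ hκb₁ hcrb₁ hccb₁ hW₁ hZ₁ rfl hτ₁ rfl hΦ₁
    (W₁ * Ab₀) (Z₁ * Qb₀ + 1) ι₁₁ ι₂₁ (W₁ * Ab₀ * (Z₁ * Qb₀ + 1) ^ 3) hA'₁0 hQ'₁0
    (fun j hj1 hjd hjn => ⟨(hkit1 j hj1 hjd hjn).1, (hkit1 j hj1 hjd hjn).2.1, (hkit1 j hj1 hjd hjn).2.2.1, (hkit1 j hj1 hjd hjn).2.2.2.1,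
      (hsm1 j hj1 hjd hjn).1, (hsm1 j hj1 hjd hjn).2.1, (hsm1 j hj1 hjd hjn).2.2.1, (hsm1 j hj1 hjd hjn).2.2.2.1, (hsm1 j hj1 hjd hjn).2.2.2.2,
      (hkit1 j hj1 hjd hjn).2.2.2.2⟩)
    (Cinc₂ * Ab₀) (Dinc₂ * Qb₀) Qtot₂ _ rfl rfl rfl (fun j => rfl)
    κb αb crb ccb (hκbd ▸ hκb) (hαbd ▸ hαb) (hcrbd ▸ hcrb) (hccbd ▸ hccb) (hκbd ▸ hκbr) (hαbd ▸ hαbr) (hcrbd ▸ hcrbr) (hccbd ▸ hccbr)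
    W Z σ τ ψ Φ hW hZ hσ hτ hψ hΦ A' Q'' hdm1 hdm2 hdm3 hdm4 hQ''0 S₂ s₄ S₆ hS₂0 hs₄ hS₆ hS₂ hS₄ hC6in
    i₁ ι₁ (16 * W * Z ^ 2 * klThinCountC * CWi ^ 4 * s₄) ι₂ ι₃
    (fun j => rfl) rfl (fun j => rfl) hι₂eq hdomAQ hdomS hnum Qe _ _ (fun j => rfl) (fun j => rfl)
    (fun j _ hjn => (hCEp (Bf * epsCoupling P U j) (ι₁ j) (hl0 j) ((hlam j hjn).trans hufm_le) (hι₁0 j) (hprod j) _ _ _ _ rfl rfl rfl rfl).trans hCEfmle)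
    (fun j hj1 hjd hjn => ((hG1j j hj1 (by omega) hjn).2.2.2.1 _ _ _ _ rfl rfl rfl rfl).trans hCEf₁le)
    hQe hT6 (fun j => t₄ * epsCoupling P U j) hS₄0 hL4 hT4 j hjn

end Summit.HubbardSuperconductivity.HubbardSuperconductivity.Theorems.EngineV8

end
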